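import Summits.MatrixMultiplication.OmegaCensus.SmallFormats.MatMul22nRankGF5XCapSlack
import HarnessLib

/-!
# ω-census family (a): METHOD LIMIT of the X-cap counting relaxation over `𝔽₅` — feasible points at slack `5` and `6`

Cell `pub-omega` (unit `pub-omega-tensor-g9`), topic `Summits/MatrixMultiplication/OmegaCensus` (sub-folder `SmallFormats`).
Framing (verbatim): lottery ticket; floor = certified bounds/negative ranges. HONEST FRAMING: this file proves NO bound on a
rank. It closes two slack levels of the census instrument behind `MatMul22nRankGF5ThreeNPlusThree` / `…ThreeNPlusFour`
(the X-marginal counting relaxation `xcapSys5s s` replayed by `BoxCert` certificates): at slack `s = 5` and `s = 6` the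
system HAS an integer point in the box `[0, s]^157` whose total is the LP value `28·s` (`140`, `168`), so by the soundness
theorem `BoxCert.Cert.sum_lt_of_check_root` NO certificate with target `T ≤ 28·s` can pass (`xcapSys5s_check_false_five/six`).
Consequently the counting relaxation cannot exclude `r = 3n + s` products for any `n ≤ 9s` at these slacks, i.e. it yields
nothing beyond the kernel LP theorem `9·R_𝔽₅(⟨2,2,n⟩) ≥ 28·n` (`MatMul22nRankFiniteField`) there. Since feasible points add
(the rows are linear with right-hand sides `s·(1, 2, 0)`), the same holds at every slack in the numerical semigroup generated by
`5` and `6` together with `15` (the uniform point `2/5` — i.e. `x ≡ 2` on invertible classes, `5` on rank-one classes); the slacks at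
which the instrument can still add a census cell over `𝔽₅` are therefore confined to `s ∈ {2, 3, 4, 7, 8, 9, 13, 14, 19}`
(`s = 2, 3` are the landed theorems). The two points were found by a prescribed-symmetry search (cell note
`pub-omega-tensor-g9/METHOD-LIMIT.md`) and ALSO satisfy the six column rank-one-plane caps (`card_vanishing_col_quant`), which
`xcapSys5s` does not contain; here only membership in `xcapSys5s s` is certified (`decide +kernel`, rows in the dictionary form
`rowMem5` / `symVar5`). Structure of the slack-6 point: `2` on every rank-one class, `1` on every invertible class outside an
octahedral subgroup `S₄ ⊂ PGL₂(𝔽₅)` and `0` on it (an `S₄` meets every coset of every Sylow-5 subgroup exactly once).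
Nothing here is progress on `ω`.
-/

namespace Summit.MatrixMultiplication.OmegaCensus.SmallFormats

open Finset

/-! ## An executable feasibility test for `xcapSys5s s` in dictionary form -/

/-- Left-hand side of a cap / row-plane row `ρ < 350` at the point `x`: `∑_{j<157, rowMem5 ρ j} x j`. -/
def xcapRowSum5 (x : ℕ → ℕ) (ρ : ℕ) : ℤ := ∑ j ∈ range 157, if rowMem5 ρ j then (x j : ℤ) else 0

/-- Rows `a, …, a + k − 1` (all `< 350`) hold at `x` for slack `s`. -/
def xcapCapOK5 (s : ℕ) (x : ℕ → ℕ) (a k : ℕ) : Bool :=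
  (List.range' a k).all fun ρ => decide (xcapRowSum5 x ρ ≤ rhs5s s ρ)

/-- The `148` WLOG rows `350 … 497` hold at `x`: `x (symVar5 ρ) ≤ x (symPivot5 ρ)`. -/
def xcapSymOK5 (x : ℕ → ℕ) : Bool :=
  (List.range' 350 148).all fun ρ => decide (x (symVar5 ρ) ≤ x (symPivot5 ρ))

/-- From the executable tests to the row inequalities. -/
theorem xcapCapOK5_spec {s : ℕ} {x : ℕ → ℕ} {a k : ℕ} (h : xcapCapOK5 s x a k = true) :
    ∀ ρ, a ≤ ρ → ρ < a + k → xcapRowSum5 x ρ ≤ rhs5s s ρ := by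
  intro ρ h1 h2
  have := List.all_eq_true.1 h ρ (by rw [List.mem_range'_1]; omega)
  exact of_decide_eq_true this

/-- From the executable WLOG test to the WLOG inequalities. -/
theorem xcapSymOK5_spec {x : ℕ → ℕ} (h : xcapSymOK5 x = true) :
    ∀ ρ, 350 ≤ ρ → ρ < 498 → x (symVar5 ρ) ≤ x (symPivot5 ρ) := by
  intro ρ h1 h2
  have := List.all_eq_true.1 h ρ (by rw [List.mem_range'_1]; omega)
  exact of_decide_eq_true this

/-- **Bridge**: a point passing all row tests is `Feasible` for `xcapSys5s s` (dictionary lemmas of the slack-2 chain). -/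
theorem feasible_xcapSys5s_of_tests {s : ℕ} {x : ℕ → ℕ}
    (hcap : ∀ ρ < 350, xcapRowSum5 x ρ ≤ rhs5s s ρ)
    (hsym : ∀ ρ, 350 ≤ ρ → ρ < 498 → x (symVar5 ρ) ≤ x (symPivot5 ρ)) :
    (xcapSys5s s).Feasible x := by
  intro ρ hρ
  change ρ < 498 at hρ
  show ∑ j ∈ range 157, (xcapSys5s s).A ρ j * (x j : ℤ) ≤ rhs5s s ρ
  have eA : ∀ j ∈ range 157, (xcapSys5s s).A ρ j * (x j : ℤ) = rowCoef5 ρ j * (x j : ℤ) := by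
    intro j hj
    rw [xcapSys5s_A, xcapSys5_A_eq' hρ (mem_range.1 hj)]
  rw [sum_congr rfl eA]
  by_cases h350 : ρ < 350
  · have eM : ∀ j ∈ range 157, rowCoef5 ρ j * (x j : ℤ) = (if rowMem5 ρ j then (x j : ℤ) else 0) := by
      intro j hj
      rw [rowCoef5_eq_mem' h350 (mem_range.1 hj)]
      split_ifs <;> simp
    rw [sum_congr rfl eM]
    exact hcap ρ h350
  · have h350' : 350 ≤ ρ := not_lt.1 h350
    have eS : ∀ j ∈ range 157, rowCoef5 ρ j * (x j : ℤ)
        = (if j = symVar5 ρ then (x j : ℤ) else 0) - (if j = symPivot5 ρ then (x j : ℤ) else 0) := by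
      intro j hj
      rw [rowCoef5_sym' hρ h350' (mem_range.1 hj)]
      split_ifs <;> simp
    rw [sum_congr rfl eS, sum_sub_distrib, sum_ite_eq' (range 157), sum_ite_eq' (range 157)]
    have hs := symVar5_lt' hρ h350'
    have hsv : symVar5 ρ ∈ range 157 := mem_range.2 (by omega)
    have hpv : symPivot5 ρ ∈ range 157 := mem_range.2 (by unfold symPivot5; split_ifs <;> norm_num)
    rw [if_pos hsv, if_pos hpv]
    have : rhs5s s ρ = 0 := by simp [rhs5s]; omega
    rw [this]
    have hw' : (x (symVar5 ρ) : ℤ) ≤ (x (symPivot5 ρ) : ℤ) := by exact_mod_cast hsym ρ h350' hρ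
    linarith

/-- **No certificate below a feasible point**: if `x ∈ [0,s]^157` is feasible for `xcapSys5s s` with total `≥ T`, every
`BoxCert` certificate for target `T` fails (contrapositive of `BoxCert.Cert.sum_lt_of_check_root`). -/
theorem xcapSys5s_check_false_of_point {s T : ℕ} (x : ℕ → ℕ) (hx : ∀ j, x j ≤ s) (hf : (xcapSys5s s).Feasible x)
    (hT : T ≤ ∑ j ∈ range 157, x j) (c : BoxCert.Cert) (D : ℕ) : c.check (xcapSys5s s) D T s [] = false := by
  rcases hc : c.check (xcapSys5s s) D T s [] with _ | _
  · rfl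
  · have hlt := BoxCert.Cert.sum_lt_of_check_root (xcapSys5s s) (xcapSys5s_colWF s) c hc x hx hf
    change ∑ j ∈ range 157, x j < T at hlt
    omega

/-! ## The slack-`5` point (total `140` = `28·5`) -/

/-- The slack-`5` point as a list in the tree's class index `xvar5` (entry `156` = zero forms = `0`); WLOG-normalised
(`x_I = x 32` is the maximum over invertible classes, `x 33 = x_diag(1,2)` the maximum over its conjugates). -/
def xcapWit5s5L : List ℕ := [1, 2, 2, 1, 2, 2, 1, 5, 1, 1, 1, 1, 1, 1, 0, 1, 0, 1, 1, 1, 1, 1, 1, 0, 1, 1, 1, 1, 1, 1, 0, 2, 1, 1, 0, 1, 0, 0, 0, 0, 0, 2, 1, 0, 1, 1, 2, 1, 1, 1, 0, 2, 0, 1, 1, 1, 2, 1, 1, 1, 0, 0, 0, 0, 0, 0, 1, 1, 2, 0, 1, 0, 1, 1, 2, 1, 1, 1, 0, 1, 2, 1, 1, 1, 1, 1, 0, 0, 5, 0, 0, 1, 1, 1, 1, 1, 1, 1, 1, 1, 1, 1, 1, 1, 1, 1, 2, 0, 1, 1, 1, 0, 0, 0, 0, 0, 0, 2, 1, 1, 1,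 1, 1, 0, 1, 2, 1, 1, 2, 1, 0, 2, 1, 0, 1, 1, 0, 0, 0, 0, 0, 1, 0, 1, 2, 1, 1, 1, 2, 0, 1, 0, 2, 1, 1, 1, 0]

/-- The slack-`5` point as a function (`0` beyond index `156`). -/
def xcapWit5s5 (j : ℕ) : ℕ := xcapWit5s5L.getD j 0

/-- Box: every entry is `≤ 5`. -/
theorem xcapWit5s5_le : ∀ j, xcapWit5s5 j ≤ 5 := by
  intro j
  by_cases hj : j < 157
  · have h : ∀ i : Fin 157, xcapWit5s5 i.val ≤ 5 := by decide +kernel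
    exact h ⟨j, hj⟩
  · have hl : xcapWit5s5L.length = 157 := by decide +kernel
    simp only [xcapWit5s5, List.getD_eq_getElem?_getD]
    rw [List.getElem?_eq_none (by omega)]
    simp

/-- Total `= 140`. -/
theorem xcapWit5s5_sum : ∑ j ∈ range 157, xcapWit5s5 j = 140 := by decide +kernel

/-- Cap rows `0 … 69`. -/
theorem xcapWit5s5_cap0 : xcapCapOK5 5 xcapWit5s5 0 70 = true := by decide +kernel

/-- Cap rows `70 … 139`. -/
theorem xcapWit5s5_cap1 : xcapCapOK5 5 xcapWit5s5 70 70 = true := by decide +kernel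

/-- Cap rows `140 … 209`. -/
theorem xcapWit5s5_cap2 : xcapCapOK5 5 xcapWit5s5 140 70 = true := by decide +kernel

/-- Cap rows `210 … 279`. -/
theorem xcapWit5s5_cap3 : xcapCapOK5 5 xcapWit5s5 210 70 = true := by decide +kernel

/-- Cap rows `280 … 349`. -/
theorem xcapWit5s5_cap4 : xcapCapOK5 5 xcapWit5s5 280 70 = true := by decide +kernel

/-- WLOG rows. -/
theorem xcapWit5s5_sym : xcapSymOK5 xcapWit5s5 = true := by decide +kernel

/-- The slack-`5` point is feasible for `xcapSys5s 5`. -/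
theorem xcapWit5s5_feasible : (xcapSys5s 5).Feasible xcapWit5s5 := by
  refine feasible_xcapSys5s_of_tests (fun ρ hρ => ?_) (xcapSymOK5_spec xcapWit5s5_sym)
  by_cases h0 : ρ < 70
  · exact xcapCapOK5_spec xcapWit5s5_cap0 ρ (by omega) (by omega)
  by_cases h1 : ρ < 140
  · exact xcapCapOK5_spec xcapWit5s5_cap1 ρ (by omega) (by omega)
  by_cases h2 : ρ < 210
  · exact xcapCapOK5_spec xcapWit5s5_cap2 ρ (by omega) (by omega)
  by_cases h3 : ρ < 280
  · exact xcapCapOK5_spec xcapWit5s5_cap3 ρ (by omega) (by omega)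
  exact xcapCapOK5_spec xcapWit5s5_cap4 ρ (by omega) (by omega)

/-- **METHOD LIMIT at slack `5` over `𝔽₅`**: no `BoxCert` certificate for `xcapSys5s 5` (box `[0,5]`) passes at any target
`T ≤ 140 = 28·5` — the counting relaxation cannot exclude `3n + 5` products for any `n ≤ 45`. -/
theorem xcapSys5s_check_false_five (c : BoxCert.Cert) (D T : ℕ) (hT : T ≤ 140) :
    c.check (xcapSys5s 5) D T 5 [] = false :=
  xcapSys5s_check_false_of_point xcapWit5s5 xcapWit5s5_le xcapWit5s5_feasible
    (by rw [xcapWit5s5_sum]; exact hT) c D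

/-! ## The slack-`6` point (total `168` = `28·6`) -/

/-- The slack-`6` point as a list in the tree's class index `xvar5` (entry `156` = zero forms = `0`); WLOG-normalised
(`x_I = x 32` is the maximum over invertible classes, `x 33 = x_diag(1,2)` the maximum over its conjugates). -/
def xcapWit5s6L : List ℕ := [2, 2, 2, 2, 2, 2, 2, 2, 2, 2, 2, 1, 1, 0, 1, 1, 1, 1, 0, 1, 1, 1, 1, 0, 1, 1, 1, 1, 0, 1, 1, 2, 1, 1, 1, 1, 2, 1, 1, 1, 1, 2, 0, 0, 0, 0, 2, 1, 1, 1, 1, 2, 1, 1, 1, 1, 2, 1, 1, 1, 0, 1, 2, 1, 0, 1, 1, 1, 2, 1, 1, 1, 0, 1, 2, 1, 0, 1, 1, 1, 2, 2, 1, 1, 0, 1, 1, 0, 2, 1, 1, 1, 1, 1, 1, 2, 1, 2, 0, 1, 1, 0, 1, 1, 2, 1, 2, 1, 0, 1, 1, 1, 1, 1, 2, 0, 1, 2, 1, 1, 1, 1, 1, 1, 0, 2, 0, 1, 2, 1, 1, 2, 0, 1, 1, 1, 1, 1, 0, 1, 2, 1, 1, 1, 2, 1, 1, 1, 2, 1,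 0, 0, 2, 1, 1, 1, 0]

/-- The slack-`6` point as a function (`0` beyond index `156`). -/
def xcapWit5s6 (j : ℕ) : ℕ := xcapWit5s6L.getD j 0

/-- Box: every entry is `≤ 6`. -/
theorem xcapWit5s6_le : ∀ j, xcapWit5s6 j ≤ 6 := by
  intro j
  by_cases hj : j < 157
  · have h : ∀ i : Fin 157, xcapWit5s6 i.val ≤ 6 := by decide +kernel
    exact h ⟨j, hj⟩
  · have hl : xcapWit5s6L.length = 157 := by decide +kernel
    simp only [xcapWit5s6, List.getD_eq_getElem?_getD]
    rw [List.getElem?_eq_none (by omega)]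
    simp

/-- Total `= 168`. -/
theorem xcapWit5s6_sum : ∑ j ∈ range 157, xcapWit5s6 j = 168 := by decide +kernel

/-- Cap rows `0 … 69`. -/
theorem xcapWit5s6_cap0 : xcapCapOK5 6 xcapWit5s6 0 70 = true := by decide +kernel

/-- Cap rows `70 … 139`. -/
theorem xcapWit5s6_cap1 : xcapCapOK5 6 xcapWit5s6 70 70 = true := by decide +kernel

/-- Cap rows `140 … 209`. -/
theorem xcapWit5s6_cap2 : xcapCapOK5 6 xcapWit5s6 140 70 = true := by decide +kernel

/-- Cap rows `210 … 279`. -/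
theorem xcapWit5s6_cap3 : xcapCapOK5 6 xcapWit5s6 210 70 = true := by decide +kernel

/-- Cap rows `280 … 349`. -/
theorem xcapWit5s6_cap4 : xcapCapOK5 6 xcapWit5s6 280 70 = true := by decide +kernel

/-- WLOG rows. -/
theorem xcapWit5s6_sym : xcapSymOK5 xcapWit5s6 = true := by decide +kernel

/-- The slack-`6` point is feasible for `xcapSys5s 6`. -/
theorem xcapWit5s6_feasible : (xcapSys5s 6).Feasible xcapWit5s6 := by
  refine feasible_xcapSys5s_of_tests (fun ρ hρ => ?_) (xcapSymOK5_spec xcapWit5s6_sym)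
  by_cases h0 : ρ < 70
  · exact xcapCapOK5_spec xcapWit5s6_cap0 ρ (by omega) (by omega)
  by_cases h1 : ρ < 140
  · exact xcapCapOK5_spec xcapWit5s6_cap1 ρ (by omega) (by omega)
  by_cases h2 : ρ < 210
  · exact xcapCapOK5_spec xcapWit5s6_cap2 ρ (by omega) (by omega)
  by_cases h3 : ρ < 280
  · exact xcapCapOK5_spec xcapWit5s6_cap3 ρ (by omega) (by omega)
  exact xcapCapOK5_spec xcapWit5s6_cap4 ρ (by omega) (by omega)

/-- **METHOD LIMIT at slack `6` over `𝔽₅`**: no `BoxCert` certificate for `xcapSys5s 6` (box `[0,6]`) passes at any target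
`T ≤ 168 = 28·6` — the counting relaxation cannot exclude `3n + 6` products for any `n ≤ 54`. -/
theorem xcapSys5s_check_false_six (c : BoxCert.Cert) (D T : ℕ) (hT : T ≤ 168) :
    c.check (xcapSys5s 6) D T 6 [] = false :=
  xcapSys5s_check_false_of_point xcapWit5s6 xcapWit5s6_le xcapWit5s6_feasible
    (by rw [xcapWit5s6_sum]; exact hT) c D

end Summit.MatrixMultiplication.OmegaCensus.SmallFormats
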